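import Summits.AnomalousDissipation.AnomalousDissipation.Statement
import Literature.Barriers.AnomalousDissipation.OnsagerSingularityLerayProofs
import Literature.Analysis.FluidPDE.LongTimeAverageSlidingWindow
import Literature.Analysis.FluidPDE.LongTimeAverageShift
import Literature.Analysis.FluidPDE.LerayHopfGeneralizedEnergyIneq
import Literature.Analysis.FluidPDE.LerayHopfRestartTorus
import Literature.Analysis.FluidPDE.DoeringFoiasPowerProofs
import Literature.Analysis.FunctionSpaces.BesovDifferenceProofs
import Literature.Analysis.FunctionSpaces.TorusFluidGlueProofs
import HarnessLib

/-!
# A long-time Onsager bound for steady-forced Leray–Hopf solutions (solo-informed, part 1)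

The in-tree barrier `Literature.Barriers.AnomalousDissipation.DrivasEyink2019_lemma1_measurable`
(Drivas–Eyink 2019, Lemma 1) controls the viscous dissipation of a Leray–Hopf solution on a FIXED
window `[0,T]` by its `L³(0,T; B^σ_{3,∞})` norm; its file states explicitly that "nothing is
asserted about `limsup_{T→∞}` time averages", which is what the summit `AnomalousDissipation`
(= `Literature.Turb.ZerothLaw`: long-time mean dissipation `⟨ν_j‖∇u_j‖₂²⟩ ≥ ε > 0` along
`ν_j → 0` for ONE steady smooth force) is about.  This file transports the bound to long-time
averages for steady smooth forcing:

* `lerayHopfOn_dissipation_le_of_scale` — the fixed-scale dissipation bound of Drivas–Eyink with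
  the data cumulant bounded by the initial kinetic energy (so only `u₀ ∈ L²` is needed):
  `ν∫₀ᵀ‖∇u‖₂² ≤ E(u₀) + 2d²C₁M₂³ε^{3σ-1} + νd²C₁²(T+M₂³)ε^{2σ-2} + 2dM₁(T+M₂³)^{1/2}ε^{2σ}`;
* `lerayHopf_window_dissipation_le`, `lerayHopf_meanDissipation_le_of_scale`,
  `lerayHopf_meanDissipation_le_rpow` — for a global Leray–Hopf solution driven by a steady smooth
  divergence-free force whose cubed `L³(0,T;B^σ_{3,∞})` norm grows at most linearly,
  `‖u‖³_{L³(0,T;B^σ_{3,∞})} ≤ AT + B` for all `T > 0`, the LONG-TIME mean dissipation obeys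
  `⟨ν‖∇u‖₂²⟩ ≤ K · ν^{(3σ-1)/(σ+1)}` for `0 < ν ≤ (1/4)^{σ+1}`, `1/3 < σ ≤ 1`, with
  `K = 2d²C₁A + d²C₁²(1+A) + 2d‖f‖_{B^σ_{2,∞}}(1+A)` independent of `ν`, of `B` and of the datum
  (they only enter terms that are `O(1/T)` in the running means);
* `lerayHopf_meanDissipation_le_rpow'` — the same for an ARBITRARY datum (restart at a good time,
  `Torus.IsGlobalLerayHopf.exists_isGlobalLerayHopf_translate` + `meanDissipation_translate`).

Consequences for zeroth-law witnesses: `SoloInformedOnsagerSingularWitness`.  All analytic input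
is in the tree (`Torus.IsLerayHopfOn.resolvedEnergyBalance_holds` = Drivas–Eyink Lemma 2, and the
time-integrated commutator bounds of `OnsagerSingularityLerayProofs`).
Reference: T. D. Drivas, G. L. Eyink, *An Onsager singularity theorem for Leray solutions of
incompressible Navier–Stokes*, Nonlinearity 32 (2019) 4465–4482, Lemmas 1–2 [DrivasEyink2019].
-/

noncomputable section

open MeasureTheory Filter Topology Set Function
open scoped ENNReal NNReal InnerProductSpace RealInnerProductSpace

namespace Summit.AnomalousDissipation.AnomalousDissipation.Theorems

open Literature.Analysis Literature.Analysis.FunctionSpaces Literature.Analysis.FluidPDE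
open Literature.Barriers.AnomalousDissipation

variable {d : Type*} [Fintype d] [DecidableEq d]

/-! ### The fixed-scale bound with an `L²` datum -/

/-- **Drivas–Eyink's dissipation bound at a fixed scale, `L²` datum** (Drivas–Eyink 2019, §2,
proof of Lemma 1, display (mainIneqFtermBND), with the data cumulant `E(u₀) - E(ū₀)` bounded by
`E(u₀)` instead of `dM₀²ε^{2σ}`): for a Leray–Hopf solution on `T^d × [0,T]` with `ν > 0`,
solenoidal measurable force `f ∈ L²(0,T;B^σ_{2,∞})`, datum `u₀ ∈ L²` and
`u ∈ L³(0,T;B^σ_{3,∞})` with norms at most `M₁`, `M₂`, and every `0 < ε ≤ 1/4`,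
`ν∫₀ᵀ‖∇u‖₂² ≤ E(u₀) + 2d²C₁M₂³ε^{3σ-1} + νd²C₁²(T+M₂³)ε^{2σ-2} + 2dM₁(T+M₂³)^{1/2}ε^{2σ}`.
[cite: DrivasEyink2019, §2, proof of Lemma 1] -/
theorem lerayHopfOn_dissipation_le_of_scale {T ν σ ε : ℝ}
    {f u : ℝ → UnitAddTorus d → EuclideanSpace ℝ d} {u₀ : UnitAddTorus d → EuclideanSpace ℝ d}
    (hT : 0 < T) (hσ : 0 < σ) (hν : 0 < ν) (hε : 0 < ε) (hε' : ε ≤ 1 / 4)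
    (h : Torus.IsLerayHopfOn T ν f u₀ u)
    (hfdiv : ∀ t, FunctionSpaces.Torus.IsWeaklyDivFree (f t))
    (hf_meas : AEStronglyMeasurable (FunctionSpaces.Torus.stLift f) (volume.restrict (Ioo 0 T ×ˢ univ)))
    (hu₀ : MemLp u₀ 2 volume) (hforce_mem : MemLpBesovSup 2 σ 2 f volume (Ioo 0 T))
    (hsol_mem : MemLpBesovSup 3 σ 3 u volume (Ioo 0 T)) {M₁ M₂ : ℝ≥0}
    (hM₁ : eLpBesovSupNorm 2 σ 2 f volume (Ioo 0 T) ≤ M₁)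
    (hM₂ : eLpBesovSupNorm 3 σ 3 u volume (Ioo 0 T) ≤ M₂) :
    ν * (∫⁻ τ in Ioo 0 T, FunctionSpaces.Torus.eGradNormSq (u τ)).toReal ≤
      FunctionSpaces.Torus.kineticEnergy u₀ +
        (Fintype.card d : ℝ) ^ 2 * (2 * FunctionSpaces.Torus.gradProfileMass d) * (M₂ : ℝ) ^ 3 * ε ^ (3 * σ - 1) +
        ν * ((Fintype.card d : ℝ) ^ 2 * FunctionSpaces.Torus.gradProfileMass d ^ 2 * (T + (M₂ : ℝ) ^ 3) * ε ^ (2 * σ - 2)) +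
        2 * (Fintype.card d : ℝ) * (M₁ : ℝ) * Real.sqrt (T + (M₂ : ℝ) ^ 3) * ε ^ (2 * σ) := by
  have hA : Torus.IsLerayHopfOn.resolvedEnergyBalance (d := d) :=
    Torus.IsLerayHopfOn.resolvedEnergyBalance_holds (d := d)
  have hum : AEStronglyMeasurable (uncurry u) ((volume.restrict (Ioo 0 T)).prod volume) :=
    Torus.aestronglyMeasurable_uncurry_restrict_prod_of_stLift h.weak.1
  have hfm : AEStronglyMeasurable (uncurry f) ((volume.restrict (Ioo 0 T)).prod volume) :=
    Torus.aestronglyMeasurable_uncurry_restrict_prod_of_stLift hf_meas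
  have hf2 : ∫⁻ t in Ioo 0 T, ∫⁻ x, ‖f t x‖ₑ ^ 2 < ⊤ :=
    lintegral_lintegral_enorm_sq_lt_top_of_memLpBesovSup hforce_mem
  have hu3 : ∫⁻ t in Ioo 0 T, ∫⁻ x, ‖u t x‖ₑ ^ 3 < ⊤ :=
    Torus.lintegral_lintegral_enorm_pow_three_lt_top_of_memLpBesovSup hsol_mem
  have hu2 : ∫⁻ t in Ioo 0 T, ∫⁻ x, ‖u t x‖ₑ ^ 2 < ⊤ := h.weak.2.1
  have hconv : FunctionSpaces.Torus.kineticEnergy (Torus.vecConv (u T) (FunctionSpaces.Torus.kernel ε)) ≤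
      FunctionSpaces.Torus.kineticEnergy (u T) :=
    Torus.kineticEnergy_vecConv_kernel_le (h.memLp T ⟨hT.le, le_rfl⟩) hε hε'
  have main := Torus.IsLerayHopfOn.dissipation_le_of_resolvedEnergyBalance hA hν h hT hfdiv hf_meas hf2
    hu₀ hu3 hε hε' hconv
  obtain ⟨-, hIg, hIB, -⟩ := hA hν h hfdiv hf_meas hf2 hu₀ hu3 hε hε'
  -- T1: the data cumulant is at most the initial energy
  have hT1 : FunctionSpaces.Torus.kineticEnergy u₀ -
      FunctionSpaces.Torus.kineticEnergy (Torus.vecConv u₀ (FunctionSpaces.Torus.kernel ε)) ≤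
      FunctionSpaces.Torus.kineticEnergy u₀ := by
    linarith [FunctionSpaces.Torus.kineticEnergy_nonneg (Torus.vecConv u₀ (FunctionSpaces.Torus.kernel ε))]
  -- T2: flux
  have hT2 := neg_integral_cetFlux_le hσ hε hε' hsol_mem h.weak.2.2.1 hM₂
  -- T3: resolved dissipation
  have hT3 := integral_gradNormSq_vecConv_le hT hσ hε hε' hsol_mem hIg hM₂
  have hT3' := mul_le_mul_of_nonneg_left hT3 hν.le
  -- T4: force cumulant
  have hIA : IntegrableOn (fun s => ∫ x, ⟪f s x, u s x⟫) (Ioo 0 T) :=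
    Torus.integrableOn_integral_inner_of_sq hfm hum hf2 hu2
  have hint : (∫ τ in (0 : ℝ)..T, ∫ x, ⟪f τ x, u τ x⟫) = ∫ s in Ioo 0 T, ∫ x, ⟪f s x, u s x⟫ := by
    rw [intervalIntegral.integral_of_le hT.le, integral_Ioc_eq_integral_Ioo]
  have hT4 := integral_inner_sub_integral_inner_vecConv_le hT hσ hε hε' hfm hum hforce_mem hsol_mem
    hIA hIB hM₁ hM₂
  rw [hint] at main
  linarith

/-! ### Steady smooth forces and time translations in `L^q_t B^σ_{p,∞}` -/

omit [DecidableEq d] in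
/-- A steady smooth field lies in `L²(0,T; B^σ_{2,∞})` for `σ ≤ 1`, with norm at most
`‖f‖_{B^σ_{2,∞}} √T` (`Torus.IsSmooth.memBesovSup_holds` and `eLpNorm` of a constant). [folklore] -/
theorem memLpBesovSup_steady {σ : ℝ} (hσ : σ ≤ 1) {f : UnitAddTorus d → EuclideanSpace ℝ d}
    (hf : Torus.IsSmooth f) {T : ℝ} (hT : 0 < T) :
    MemLpBesovSup 2 σ 2 (fun _ : ℝ => f) volume (Ioo 0 T) ∧
      eLpBesovSupNorm 2 σ 2 (fun _ : ℝ => f) volume (Ioo 0 T) ≤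
        (((eBesovSupNorm σ 2 f volume).toReal * Real.sqrt T).toNNReal : ℝ≥0) := by
  have hB : MemBesovSup σ 2 f volume := Torus.IsSmooth.memBesovSup_holds hf hσ 2
  have hF0 : 0 ≤ (eBesovSupNorm σ 2 f volume).toReal := ENNReal.toReal_nonneg
  have hbound : eLpBesovSupNorm 2 σ 2 (fun _ : ℝ => f) volume (Ioo 0 T) ≤
      ENNReal.ofReal ((eBesovSupNorm σ 2 f volume).toReal * Real.sqrt T) := by
    unfold eLpBesovSupNorm
    refine (eLpNorm_le_of_ae_bound (C := (eBesovSupNorm σ 2 f volume).toReal)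
      (Eventually.of_forall fun t => ?_)).trans (le_of_eq ?_)
    · exact (Real.norm_of_nonneg hF0).le
    · rw [Measure.restrict_apply_univ, Real.volume_Ioo, sub_zero, ENNReal.toReal_ofNat,
        ENNReal.ofReal_rpow_of_nonneg hT.le (by norm_num),
        ← ENNReal.ofReal_mul (Real.rpow_nonneg hT.le _), Real.sqrt_eq_rpow, one_div, mul_comm]
  have hco : (((((eBesovSupNorm σ 2 f volume).toReal * Real.sqrt T).toNNReal : ℝ≥0)) : ℝ≥0∞) =
      ENNReal.ofReal ((eBesovSupNorm σ 2 f volume).toReal * Real.sqrt T) := rfl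
  refine ⟨⟨Eventually.of_forall fun _ => hB, hbound.trans_lt ENNReal.ofReal_lt_top⟩, ?_⟩
  rw [hco]
  exact hbound

omit [DecidableEq d] in
/-- Time translation does not increase the `L³_t B^σ_{3,∞}` norm:
`‖u(· + s)‖_{L³(0,T;B^σ_{3,∞})} ≤ ‖u‖_{L³(0,T+s;B^σ_{3,∞})}` for `s ≥ 0` (translation invariance
of Lebesgue measure and monotonicity in the window). [folklore] -/
theorem eLpBesovSupNorm_translate_le {σ : ℝ} (u : ℝ → UnitAddTorus d → EuclideanSpace ℝ d)
    {s : ℝ} (hs : 0 ≤ s) (T : ℝ) :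
    eLpBesovSupNorm 3 σ 3 (fun t => u (t + s)) volume (Ioo 0 T) ≤
      eLpBesovSupNorm 3 σ 3 u volume (Ioo 0 (T + s)) := by
  unfold eLpBesovSupNorm
  have h3 : (3 : ℝ≥0∞) ≠ 0 := by norm_num
  have h3' : (3 : ℝ≥0∞) ≠ ⊤ := by norm_num
  rw [eLpNorm_eq_lintegral_rpow_enorm_toReal h3 h3', eLpNorm_eq_lintegral_rpow_enorm_toReal h3 h3']
  refine ENNReal.rpow_le_rpow ?_ (by positivity)
  calc ∫⁻ t in Ioo 0 T, ‖(eBesovSupNorm σ 3 (u (t + s)) volume).toReal‖ₑ ^ (3 : ℝ≥0∞).toReal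
      = ∫⁻ t in Ioo (0 + s) (T + s), ‖(eBesovSupNorm σ 3 (u t) volume).toReal‖ₑ ^ (3 : ℝ≥0∞).toReal :=
        setLIntegral_Ioo_add_right
          (fun t => ‖(eBesovSupNorm σ 3 (u t) volume).toReal‖ₑ ^ (3 : ℝ≥0∞).toReal) 0 T s
    _ ≤ ∫⁻ t in Ioo 0 (T + s), ‖(eBesovSupNorm σ 3 (u t) volume).toReal‖ₑ ^ (3 : ℝ≥0∞).toReal :=
        lintegral_mono_set (Ioo_subset_Ioo (by linarith) le_rfl)

omit [DecidableEq d] in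
/-- Time translation preserves membership in `L³_t B^σ_{3,∞}`:
`u ∈ L³(0,T+s;B^σ_{3,∞}) ⇒ u(· + s) ∈ L³(0,T;B^σ_{3,∞})` for `s ≥ 0`. [folklore] -/
theorem memLpBesovSup_translate {σ : ℝ} {u : ℝ → UnitAddTorus d → EuclideanSpace ℝ d} {s T : ℝ}
    (hs : 0 ≤ s) (h : MemLpBesovSup 3 σ 3 u volume (Ioo 0 (T + s))) :
    MemLpBesovSup 3 σ 3 (fun t => u (t + s)) volume (Ioo 0 T) := by
  refine ⟨?_, (eLpBesovSupNorm_translate_le u hs T).trans_lt h.2⟩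
  have h1 : ∀ᵐ t ∂(volume.restrict (Ioo (s + 0) (s + T))), MemBesovSup σ 3 (u t) volume :=
    ae_restrict_of_ae_restrict_of_subset (Ioo_subset_Ioo (by linarith) (by linarith)) h.1
  filter_upwards [ae_restrict_Ioo_add_left s h1] with t ht
  show MemBesovSup σ 3 (u (t + s)) volume
  rw [add_comm]
  exact ht

/-! ### One global Leray–Hopf solution with a steady smooth force -/

/-- **Window bound.** For a global Leray–Hopf solution on `T^d` with `ν > 0`, steady smooth
divergence-free force `f`, datum `u₀ ∈ L²`, and `u ∈ L³(0,T;B^σ_{3,∞})` with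
`‖u‖³_{L³(0,T;B^σ_{3,∞})} ≤ AT + B` for every `T > 0` (`0 < σ ≤ 1`, `A, B ≥ 0`), and every
`0 < ε ≤ 1/4`: `ν∫₀ᵀ‖∇u‖₂² ≤ E(u₀) + 2d²C₁(AT+B)ε^{3σ-1} + νd²C₁²(T+AT+B)ε^{2σ-2}
+ 2d‖f‖_{B^σ_{2,∞}}(T+AT+B)ε^{2σ}` — linear in `T`. [cite: DrivasEyink2019, §2, proof of Lemma 1] -/
theorem lerayHopf_window_dissipation_le {ν σ ε A B : ℝ} (hσ : 0 < σ ∧ σ ≤ 1) (hν : 0 < ν)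
    (hε : 0 < ε) (hε' : ε ≤ 1 / 4)
    {f : UnitAddTorus d → EuclideanSpace ℝ d} (hf : Torus.IsSmooth f) (hdiv : Torus.IsDivFree f)
    {u₀ : UnitAddTorus d → EuclideanSpace ℝ d} {u : ℝ → UnitAddTorus d → EuclideanSpace ℝ d}
    (hu : Torus.IsGlobalLerayHopf ν (fun _ => f) u₀ u) (hu₀ : MemLp u₀ 2 volume)
    (hreg : ∀ T, 0 < T → MemLpBesovSup 3 σ 3 u volume (Ioo 0 T) ∧
      (eLpBesovSupNorm 3 σ 3 u volume (Ioo 0 T)).toReal ^ 3 ≤ A * T + B)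
    {T : ℝ} (hT : 0 < T) :
    ν * (∫⁻ τ in Ioo 0 T, FunctionSpaces.Torus.eGradNormSq (u τ)).toReal ≤
      FunctionSpaces.Torus.kineticEnergy u₀ +
        (Fintype.card d : ℝ) ^ 2 * (2 * FunctionSpaces.Torus.gradProfileMass d) * (A * T + B) * ε ^ (3 * σ - 1) +
        ν * ((Fintype.card d : ℝ) ^ 2 * FunctionSpaces.Torus.gradProfileMass d ^ 2 * (T + A * T + B) * ε ^ (2 * σ - 2)) +
        2 * (Fintype.card d : ℝ) * (eBesovSupNorm σ 2 f volume).toReal * (T + A * T + B) * ε ^ (2 * σ) := by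
  obtain ⟨hmem, hcube⟩ := hreg T hT
  have hfin : eLpBesovSupNorm 3 σ 3 u volume (Ioo 0 T) ≠ ⊤ := hmem.2.ne
  have hM₂ : eLpBesovSupNorm 3 σ 3 u volume (Ioo 0 T) ≤
      ((eLpBesovSupNorm 3 σ 3 u volume (Ioo 0 T)).toNNReal : ℝ≥0∞) := (ENNReal.coe_toNNReal hfin).ge
  have hM₂cube : (((eLpBesovSupNorm 3 σ 3 u volume (Ioo 0 T)).toNNReal : ℝ≥0) : ℝ) ^ 3 ≤ A * T + B := hcube
  obtain ⟨hforce_mem, hM₁⟩ := memLpBesovSup_steady (d := d) hσ.2 hf hT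
  have key := lerayHopfOn_dissipation_le_of_scale hT hσ.1 hν hε hε' (hu T hT)
    (fun _ => Torus.IsDivFree.isWeaklyDivFree_holds hf hdiv)
    (aestronglyMeasurable_stLift_steady hf.continuous _) hu₀ hforce_mem hmem hM₁ hM₂
  have hF0 : 0 ≤ (eBesovSupNorm σ 2 f volume).toReal := ENNReal.toReal_nonneg
  rw [Real.coe_toNNReal _ (mul_nonneg hF0 (Real.sqrt_nonneg T))] at key
  set D : ℝ := (Fintype.card d : ℝ) with hD
  set C₁ : ℝ := FunctionSpaces.Torus.gradProfileMass d with hC₁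
  set F₁ : ℝ := (eBesovSupNorm σ 2 f volume).toReal with hF₁
  set M : ℝ := (((eLpBesovSupNorm 3 σ 3 u volume (Ioo 0 T)).toNNReal : ℝ≥0) : ℝ) with hM
  have hC₁0 : 0 ≤ C₁ := FunctionSpaces.Torus.gradProfileMass_nonneg (d := d)
  have hD0 : 0 ≤ D := Nat.cast_nonneg _
  have hM0 : 0 ≤ M := NNReal.coe_nonneg _
  have hM3 : 0 ≤ M ^ 3 := by positivity
  have hX : T + M ^ 3 ≤ T + A * T + B := by linarith
  have hX0 : 0 ≤ T + M ^ 3 := by positivity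
  have hε₁ : 0 ≤ ε ^ (3 * σ - 1) := Real.rpow_nonneg hε.le _
  have hε₂ : 0 ≤ ε ^ (2 * σ - 2) := Real.rpow_nonneg hε.le _
  have hε₃ : 0 ≤ ε ^ (2 * σ) := Real.rpow_nonneg hε.le _
  have i2 : D ^ 2 * (2 * C₁) * M ^ 3 * ε ^ (3 * σ - 1) ≤
      D ^ 2 * (2 * C₁) * (A * T + B) * ε ^ (3 * σ - 1) :=
    mul_le_mul_of_nonneg_right (mul_le_mul_of_nonneg_left hM₂cube (by positivity)) hε₁
  have i3 : ν * (D ^ 2 * C₁ ^ 2 * (T + M ^ 3) * ε ^ (2 * σ - 2)) ≤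
      ν * (D ^ 2 * C₁ ^ 2 * (T + A * T + B) * ε ^ (2 * σ - 2)) :=
    mul_le_mul_of_nonneg_left
      (mul_le_mul_of_nonneg_right (mul_le_mul_of_nonneg_left hX (by positivity)) hε₂) hν.le
  have hsq : Real.sqrt T * Real.sqrt (T + M ^ 3) ≤ T + A * T + B := by
    have h1 : Real.sqrt T ≤ Real.sqrt (T + M ^ 3) := Real.sqrt_le_sqrt (by linarith)
    calc Real.sqrt T * Real.sqrt (T + M ^ 3)
        ≤ Real.sqrt (T + M ^ 3) * Real.sqrt (T + M ^ 3) :=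
          mul_le_mul_of_nonneg_right h1 (Real.sqrt_nonneg _)
      _ = T + M ^ 3 := Real.mul_self_sqrt hX0
      _ ≤ T + A * T + B := hX
  have i4 : 2 * D * (F₁ * Real.sqrt T) * Real.sqrt (T + M ^ 3) * ε ^ (2 * σ) ≤
      2 * D * F₁ * (T + A * T + B) * ε ^ (2 * σ) := by
    have : 2 * D * (F₁ * Real.sqrt T) * Real.sqrt (T + M ^ 3) * ε ^ (2 * σ) =
        2 * D * F₁ * (Real.sqrt T * Real.sqrt (T + M ^ 3)) * ε ^ (2 * σ) := by ring
    rw [this]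
    exact mul_le_mul_of_nonneg_right (mul_le_mul_of_nonneg_left hsq (by positivity)) hε₃
  linarith

/-- **Long-time bound at a fixed scale.** Under the hypotheses of
`lerayHopf_window_dissipation_le`, the long-time mean dissipation obeys, for every
`0 < ε ≤ 1/4`, `⟨ν‖∇u‖₂²⟩ ≤ 2d²C₁Aε^{3σ-1} + νd²C₁²(1+A)ε^{2σ-2} + 2d‖f‖_{B^σ_{2,∞}}(1+A)ε^{2σ}`
(the datum and `B` contribute `O(1/T)` to the running means). [cite: DrivasEyink2019, §2, proof of Lemma 1] -/
theorem lerayHopf_meanDissipation_le_of_scale {ν σ ε A B : ℝ} (hσ : 0 < σ ∧ σ ≤ 1) (hν : 0 < ν)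
    (hε : 0 < ε) (hε' : ε ≤ 1 / 4) (hB : 0 ≤ B)
    {f : UnitAddTorus d → EuclideanSpace ℝ d} (hf : Torus.IsSmooth f) (hdiv : Torus.IsDivFree f)
    {u₀ : UnitAddTorus d → EuclideanSpace ℝ d} {u : ℝ → UnitAddTorus d → EuclideanSpace ℝ d}
    (hu : Torus.IsGlobalLerayHopf ν (fun _ => f) u₀ u) (hu₀ : MemLp u₀ 2 volume)
    (hreg : ∀ T, 0 < T → MemLpBesovSup 3 σ 3 u volume (Ioo 0 T) ∧
      (eLpBesovSupNorm 3 σ 3 u volume (Ioo 0 T)).toReal ^ 3 ≤ A * T + B) :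
    meanDissipation ν u ≤
      (Fintype.card d : ℝ) ^ 2 * (2 * FunctionSpaces.Torus.gradProfileMass d) * A * ε ^ (3 * σ - 1) +
        ν * ((Fintype.card d : ℝ) ^ 2 * FunctionSpaces.Torus.gradProfileMass d ^ 2 * (1 + A) * ε ^ (2 * σ - 2)) +
        2 * (Fintype.card d : ℝ) * (eBesovSupNorm σ 2 f volume).toReal * (1 + A) * ε ^ (2 * σ) := by
  set D : ℝ := (Fintype.card d : ℝ) with hD
  set C₁ : ℝ := FunctionSpaces.Torus.gradProfileMass d with hC₁
  set F₁ : ℝ := (eBesovSupNorm σ 2 f volume).toReal with hF₁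
  set R : ℝ := D ^ 2 * (2 * C₁) * A * ε ^ (3 * σ - 1) + ν * (D ^ 2 * C₁ ^ 2 * (1 + A) * ε ^ (2 * σ - 2)) +
    2 * D * F₁ * (1 + A) * ε ^ (2 * σ) with hR
  set S : ℝ := FunctionSpaces.Torus.kineticEnergy u₀ + D ^ 2 * (2 * C₁) * B * ε ^ (3 * σ - 1) +
    ν * (D ^ 2 * C₁ ^ 2 * B * ε ^ (2 * σ - 2)) + 2 * D * F₁ * B * ε ^ (2 * σ) with hS
  have hC₁0 : 0 ≤ C₁ := FunctionSpaces.Torus.gradProfileMass_nonneg (d := d)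
  have hD0 : 0 ≤ D := Nat.cast_nonneg _
  have hF0 : 0 ≤ F₁ := ENNReal.toReal_nonneg
  have hE0 : 0 ≤ FunctionSpaces.Torus.kineticEnergy u₀ := FunctionSpaces.Torus.kineticEnergy_nonneg u₀
  have hε₁ : 0 ≤ ε ^ (3 * σ - 1) := Real.rpow_nonneg hε.le _
  have hε₂ : 0 ≤ ε ^ (2 * σ - 2) := Real.rpow_nonneg hε.le _
  have hε₃ : 0 ≤ ε ^ (2 * σ) := Real.rpow_nonneg hε.le _
  have hS0 : 0 ≤ S := by positivity
  -- the running means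
  have hmean : ∀ T, 0 < T →
      timeMean (fun t => ν * (FunctionSpaces.Torus.eGradNormSq (u t)).toReal) T ≤ R + S / T := by
    intro T hT
    have hw := lerayHopf_window_dissipation_le hσ hν hε hε' hf hdiv hu hu₀ hreg hT
    have hDint := (hu.setIntegral_toReal_eGradNormSq (s := 0) (t := T) le_rfl).2
    have hwin : ν * (∫⁻ τ in Ioo 0 T, FunctionSpaces.Torus.eGradNormSq (u τ)).toReal ≤ S + R * T := by
      have : FunctionSpaces.Torus.kineticEnergy u₀ +
          D ^ 2 * (2 * C₁) * (A * T + B) * ε ^ (3 * σ - 1) +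
          ν * (D ^ 2 * C₁ ^ 2 * (T + A * T + B) * ε ^ (2 * σ - 2)) +
          2 * D * F₁ * (T + A * T + B) * ε ^ (2 * σ) = S + R * T := by
        rw [hS, hR]; ring
      linarith
    unfold timeMean
    rw [intervalIntegral.integral_of_le hT.le, integral_const_mul, hDint]
    calc T⁻¹ * (ν * (∫⁻ τ in Ioo 0 T, FunctionSpaces.Torus.eGradNormSq (u τ)).toReal)
        ≤ T⁻¹ * (S + R * T) := mul_le_mul_of_nonneg_left hwin (inv_nonneg.2 hT.le)
      _ = R + S / T := by field_simp; ring
  -- pass to the limsup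
  show longTimeAvgSup (fun t => ν * (FunctionSpaces.Torus.eGradNormSq (u t)).toReal) ≤ R
  refine le_of_forall_pos_le_add fun δ hδ => ?_
  refine longTimeAvgSup_le_of_eventually_le (fun t => mul_nonneg hν.le ENNReal.toReal_nonneg) ?_
  filter_upwards [eventually_gt_atTop (0 : ℝ), eventually_ge_atTop (S / δ)] with T hT hTδ
  have hST : S / T ≤ δ := by
    rw [div_le_iff₀ hT]
    have := (div_le_iff₀ hδ).1 hTδ
    linarith [mul_comm T δ]
  linarith [hmean T hT]

/-- **Long-time Onsager bound with the Drivas–Eyink scale `ε = ν^{1/(σ+1)}`.** For a global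
Leray–Hopf solution on `T^d` with steady smooth divergence-free force `f`, datum `u₀ ∈ L²`,
`1/3 < σ ≤ 1`, `0 < ν ≤ (1/4)^{σ+1}` and `‖u‖³_{L³(0,T;B^σ_{3,∞})} ≤ AT + B` for all `T > 0`:
`⟨ν‖∇u‖₂²⟩ ≤ (2d²C₁A + d²C₁²(1+A) + 2d‖f‖_{B^σ_{2,∞}}(1+A)) · ν^{(3σ-1)/(σ+1)}`.
[cite: DrivasEyink2019, Lemma 1] -/
theorem lerayHopf_meanDissipation_le_rpow {ν σ A B : ℝ} (hσ : 1 / 3 < σ ∧ σ ≤ 1) (hν : 0 < ν)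
    (hν' : ν ≤ (1 / 4 : ℝ) ^ (σ + 1)) (hA : 0 ≤ A) (hB : 0 ≤ B)
    {f : UnitAddTorus d → EuclideanSpace ℝ d} (hf : Torus.IsSmooth f) (hdiv : Torus.IsDivFree f)
    {u₀ : UnitAddTorus d → EuclideanSpace ℝ d} {u : ℝ → UnitAddTorus d → EuclideanSpace ℝ d}
    (hu : Torus.IsGlobalLerayHopf ν (fun _ => f) u₀ u) (hu₀ : MemLp u₀ 2 volume)
    (hreg : ∀ T, 0 < T → MemLpBesovSup 3 σ 3 u volume (Ioo 0 T) ∧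
      (eLpBesovSupNorm 3 σ 3 u volume (Ioo 0 T)).toReal ^ 3 ≤ A * T + B) :
    meanDissipation ν u ≤
      ((Fintype.card d : ℝ) ^ 2 * (2 * FunctionSpaces.Torus.gradProfileMass d) * A +
        (Fintype.card d : ℝ) ^ 2 * FunctionSpaces.Torus.gradProfileMass d ^ 2 * (1 + A) +
        2 * (Fintype.card d : ℝ) * (eBesovSupNorm σ 2 f volume).toReal * (1 + A)) *
        ν ^ ((3 * σ - 1) / (σ + 1)) := by
  have hσ0 : 0 < σ := by linarith [hσ.1]
  have hσ1 : 0 < σ + 1 := by linarith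
  set p : ℝ := (3 * σ - 1) / (σ + 1) with hp
  set ε : ℝ := ν ^ (1 / (σ + 1)) with hε_def
  have hε : 0 < ε := Real.rpow_pos_of_pos hν _
  have hε' : ε ≤ 1 / 4 := by
    calc ε ≤ ((1 / 4 : ℝ) ^ (σ + 1)) ^ (1 / (σ + 1)) :=
          Real.rpow_le_rpow hν.le hν' (by positivity)
      _ = 1 / 4 := by
          rw [← Real.rpow_mul (by norm_num), mul_one_div_cancel hσ1.ne', Real.rpow_one]
  have hε1 : ε ≤ 1 := hε'.trans (by norm_num)
  have key := lerayHopf_meanDissipation_le_of_scale ⟨hσ0, hσ.2⟩ hν hε hε' hB hf hdiv hu hu₀ hreg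
  set a : ℝ := (Fintype.card d : ℝ) ^ 2 * (2 * FunctionSpaces.Torus.gradProfileMass d) * A with ha
  set c : ℝ := (Fintype.card d : ℝ) ^ 2 * FunctionSpaces.Torus.gradProfileMass d ^ 2 * (1 + A) with hc
  set e : ℝ := 2 * (Fintype.card d : ℝ) * (eBesovSupNorm σ 2 f volume).toReal * (1 + A) with he
  have hC₁0 : 0 ≤ FunctionSpaces.Torus.gradProfileMass d := FunctionSpaces.Torus.gradProfileMass_nonneg (d := d)
  have ha0 : 0 ≤ a := by positivity
  have he0 : 0 ≤ e := by positivity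
  -- exponent bookkeeping (as in `DrivasEyink2019_lemma1_measurable_of_resolvedEnergyBalance`)
  have e1 : ε ^ (3 * σ - 1) = ν ^ p := by
    rw [hε_def, ← Real.rpow_mul hν.le]
    congr 1
    rw [hp]; field_simp
  have e2 : ν * ε ^ (2 * σ - 2) = ν ^ p := by
    rw [hε_def, ← Real.rpow_mul hν.le]
    conv_lhs => rw [show ν * ν ^ (1 / (σ + 1) * (2 * σ - 2)) =
        ν ^ (1 : ℝ) * ν ^ (1 / (σ + 1) * (2 * σ - 2)) by rw [Real.rpow_one]]
    rw [← Real.rpow_add hν]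
    congr 1
    rw [hp]; field_simp; ring
  have e3 : ε ^ (2 * σ) ≤ ε ^ (3 * σ - 1) :=
    Real.rpow_le_rpow_of_exponent_ge hε hε1 (by linarith [hσ.2])
  have i1 : a * ε ^ (3 * σ - 1) = a * ν ^ p := by rw [e1]
  have i2 : ν * (c * ε ^ (2 * σ - 2)) = c * ν ^ p := by rw [← e2]; ring
  have i3 : e * ε ^ (2 * σ) ≤ e * ν ^ p := mul_le_mul_of_nonneg_left (e3.trans_eq e1) he0
  calc meanDissipation ν u
      ≤ a * ε ^ (3 * σ - 1) + ν * (c * ε ^ (2 * σ - 2)) + e * ε ^ (2 * σ) := by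
        simpa only [ha, hc, he, mul_assoc] using key
    _ ≤ a * ν ^ p + c * ν ^ p + e * ν ^ p := by linarith
    _ = (a + c + e) * ν ^ p := by ring

/-- **The same bound for an arbitrary datum** (not assumed in `L²` or measurable): the solution is
restarted at a good time `s > 0` (`Torus.IsGlobalLerayHopf.exists_isGlobalLerayHopf_translate`,
datum `u(s) ∈ L²`), which changes neither the long-time mean dissipation
(`Torus.IsGlobalLerayHopf.meanDissipation_translate`) nor the slope `A` of the cubed
`L³_t B^σ_{3,∞}` norm. [cite: DrivasEyink2019, Lemma 1] -/
theorem lerayHopf_meanDissipation_le_rpow' {ν σ A B : ℝ} (hσ : 1 / 3 < σ ∧ σ ≤ 1) (hν : 0 < ν)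
    (hν' : ν ≤ (1 / 4 : ℝ) ^ (σ + 1)) (hA : 0 ≤ A)
    {f : UnitAddTorus d → EuclideanSpace ℝ d} (hf : Torus.IsSmooth f) (hdiv : Torus.IsDivFree f)
    {u₀ : UnitAddTorus d → EuclideanSpace ℝ d} {u : ℝ → UnitAddTorus d → EuclideanSpace ℝ d}
    (hu : Torus.IsGlobalLerayHopf ν (fun _ => f) u₀ u)
    (hreg : ∀ T, 0 < T → MemLpBesovSup 3 σ 3 u volume (Ioo 0 T) ∧
      (eLpBesovSupNorm 3 σ 3 u volume (Ioo 0 T)).toReal ^ 3 ≤ A * T + B) :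
    meanDissipation ν u ≤
      ((Fintype.card d : ℝ) ^ 2 * (2 * FunctionSpaces.Torus.gradProfileMass d) * A +
        (Fintype.card d : ℝ) ^ 2 * FunctionSpaces.Torus.gradProfileMass d ^ 2 * (1 + A) +
        2 * (Fintype.card d : ℝ) * (eBesovSupNorm σ 2 f volume).toReal * (1 + A)) *
        ν ^ ((3 * σ - 1) / (σ + 1)) := by
  obtain ⟨s, hs, -, hus⟩ := hu.exists_isGlobalLerayHopf_translate hf hν.le
  have hus₀ : MemLp (u s) 2 volume := (hu (s + 1) (by linarith)).memLp s ⟨hs.le, by linarith⟩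
  have hB' : 0 ≤ A * s + max B 0 := add_nonneg (mul_nonneg hA hs.le) (le_max_right _ _)
  have hreg' : ∀ T, 0 < T → MemLpBesovSup 3 σ 3 (fun t => u (t + s)) volume (Ioo 0 T) ∧
      (eLpBesovSupNorm 3 σ 3 (fun t => u (t + s)) volume (Ioo 0 T)).toReal ^ 3 ≤
        A * T + (A * s + max B 0) := by
    intro T hT
    obtain ⟨hm, hc⟩ := hreg (T + s) (by linarith)
    refine ⟨memLpBesovSup_translate hs.le hm, ?_⟩
    have hle : (eLpBesovSupNorm 3 σ 3 (fun t => u (t + s)) volume (Ioo 0 T)).toReal ≤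
        (eLpBesovSupNorm 3 σ 3 u volume (Ioo 0 (T + s))).toReal :=
      ENNReal.toReal_mono hm.2.ne (eLpBesovSupNorm_translate_le u hs.le T)
    calc (eLpBesovSupNorm 3 σ 3 (fun t => u (t + s)) volume (Ioo 0 T)).toReal ^ 3
        ≤ (eLpBesovSupNorm 3 σ 3 u volume (Ioo 0 (T + s))).toReal ^ 3 :=
          pow_le_pow_left₀ ENNReal.toReal_nonneg hle 3
      _ ≤ A * (T + s) + B := hc
      _ ≤ A * T + (A * s + max B 0) := by linarith [le_max_left B 0]
  rw [← hu.meanDissipation_translate hν.le hs.le]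
  exact lerayHopf_meanDissipation_le_rpow hσ hν hν' hA hB' hf hdiv hus hus₀ hreg'

end Summit.AnomalousDissipation.AnomalousDissipation.Theorems

end
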